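import Literature.Probability.RandomPlanarGeometry.LoewnerInverseMeasurable
import Literature.Probability.RandomPlanarGeometry.LoewnerInverseContinuity
import Literature.Probability.RandomPlanarGeometry.SLETraceApproximation
import HarnessLib

/-!
# A measurable version of the SLE Markov-kernel parametrisation `ψ = Φ ∘ f̄ᵣ(· + W r)`

Trunk T-STOCH. In the domain Markov property of chordal SLE (Rohde–Schramm (2005), §2 and
Thm. 5.1 with the Markov property of the driving Brownian motion; Lawler (2005), §6.3), the
conditional law of the future of the curve given the explored past — the driving path `W`
stopped at a time `r` — is the law of the image of a FRESH SLE trace under the map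
`ψ = Φ ∘ f̄ᵣ(· + W r)`, where `f̄ᵣ` is the boundary extension of `fᵣ = gᵣ⁻¹`
(`Literature.Probability.RandomPlanarGeometry.Loewner.bdryInv`) and `Φ` the (boundary extension
of the) uniformizing map of the domain. To feed this into a strong-Markov / freezing formula one
needs a version of `ψ` which is **jointly Borel measurable** in the past `(W, r)` and the point.
This file supplies it:

* `Literature.Probability.RandomPlanarGeometry.psiTilde Φ W r w` — the limit, as `n → ∞`, of
  `Φ (fᵣ (liftIm 0 w + W r + i/(n+1)))` (approach from inside `ℍₒ` along the vertical; `liftIm 0`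
  is the retraction of `ℂ` onto the closed half-plane);
* `Loewner.measurable_loewnerInv_continuousMap` — joint measurability of
  `((W, r), w) ↦ fᵣ^W (liftIm 0 w + W r + i y)` on `(C(ℝ≥0, ℝ) × ℝ≥0) × ℂ` (`y > 0`): measurable in
  `W` at a fixed point of `ℍₒ` (`Loewner.measurable_loewnerInv`: Bernstein approximation of the
  driver and Grönwall stability of the backward flow, Rohde–Schramm (2005), §3 p. 896), jointly
  continuous in `(r, z)` on `[0, ∞) × ℍₒ` (`Loewner.continuousAt_loewnerInv_uncurry`), hence jointly
  measurable (Mathlib `measurable_uncurry_of_continuous_of_measurable`);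
* `measurable_psiTilde` — hence `psiTilde Φ` is jointly measurable for Borel `Φ`
  (Mathlib `MeasureTheory.StronglyMeasurable.limUnder`);
* `psiTilde_eq_of_isGeneratedByCurve` — for a driver generated by a curve and `Φ` continuous on
  the closed half-plane, `psiTilde Φ W r w = Φ (f̄ᵣ (liftIm 0 w + W r))`
  (`IsGeneratedByCurve.tendsto_bdryInv`: `f̄ᵣ` is the limit of `fᵣ` from inside `ℍₒ`).

## References

* S. Rohde, O. Schramm, *Basic properties of SLE*, Ann. of Math. 161 (2005), §3 p. 896
  (measurability of `f̂ₛ` in the driver), Thm. 5.1.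
* G. F. Lawler, *Conformally Invariant Processes in the Plane*, AMS (2005), §4.1, Rem. 4.32, §6.3.
-/

noncomputable section

open Set Filter Topology MeasureTheory Complex
open UpperHalfPlane (upperHalfPlaneSet)
open scoped NNReal

namespace Literature.Probability.RandomPlanarGeometry

open scoped PathBorel

/-! ### Joint measurability of `((W, r), w) ↦ fᵣ^W (liftIm 0 w + W r + i y)` -/

namespace Loewner

/-- The point `liftIm 0 w + x + i y` (`x` real, `y > 0`) lies in `ℍₒ`: its imaginary part is
`max (im w) 0 + y ≥ y > 0`. [folklore] -/
theorem im_liftIm_add_ofReal_add_pos (w : ℂ) (x : ℝ) {y : ℝ} (hy : 0 < y) :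
    0 < (liftIm 0 w + (x : ℂ) + Complex.I * (y : ℂ)).im := by
  have h : (liftIm 0 w + (x : ℂ) + Complex.I * (y : ℂ)).im = max w.im 0 + y := by
    simp [liftIm_im]
  rw [h]
  exact add_pos_of_nonneg_of_pos (le_max_right _ _) hy

/-- **`W ↦ fᵣ^W(z)` is Borel measurable on `C(ℝ≥0, ℝ)`** for fixed `r` and `z ∈ ℍₒ`
(`Loewner.measurable_loewnerInv` for the identity family of continuous paths, whose evaluations
are continuous hence Borel). Rohde–Schramm (2005), §3 p. 896. [cite: RohdeSchramm2005, §3 p. 896] -/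
theorem measurable_loewnerInv_continuousMap_apply (r : ℝ≥0) {z : ℂ} (hz : 0 < z.im) :
    Measurable fun W : C(ℝ≥0, ℝ) ↦ loewnerInv W r z :=
  measurable_loewnerInv (X := fun W : C(ℝ≥0, ℝ) ↦ (W : ℝ≥0 → ℝ)) (t := r)
    (fun W ↦ W.continuous) (fun s _ ↦ (continuous_eval_const (F := C(ℝ≥0, ℝ)) s).measurable) hz

/-- For a continuous driver `W` and `y > 0`, `(r, w) ↦ fᵣ (liftIm 0 w + W r + i y)` is continuous
on `ℝ≥0 × ℂ` (joint continuity of `(t, z) ↦ fₜ(z)` on `[0, ∞) × ℍₒ`,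
`continuousAt_loewnerInv_uncurry`, at points of `ℍₒ`). [folklore] -/
theorem continuous_loewnerInv_liftIm {W : ℝ≥0 → ℝ} (hW : Continuous W) {y : ℝ} (hy : 0 < y) :
    Continuous fun q : ℝ≥0 × ℂ ↦
      loewnerInv W q.1 (liftIm 0 q.2 + (W q.1 : ℂ) + Complex.I * (y : ℂ)) := by
  have hin : Continuous fun q : ℝ≥0 × ℂ ↦
      (q.1, liftIm 0 q.2 + (W q.1 : ℂ) + Complex.I * (y : ℂ)) :=
    continuous_fst.prodMk ((((lipschitzWith_liftIm 0).continuous.comp continuous_snd).add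
      (continuous_ofReal.comp (hW.comp continuous_fst))).add continuous_const)
  refine continuous_iff_continuousAt.2 fun q ↦ ?_
  have key : Tendsto ((fun p : ℝ≥0 × ℂ ↦ loewnerInv W p.1 p.2) ∘ fun q : ℝ≥0 × ℂ ↦
      (q.1, liftIm 0 q.2 + (W q.1 : ℂ) + Complex.I * (y : ℂ))) (𝓝 q) (𝓝 _) :=
    (continuousAt_loewnerInv_uncurry hW q.1
      (im_liftIm_add_ofReal_add_pos q.2 (W q.1) hy)).tendsto.comp hin.continuousAt
  exact key

/-- For fixed `r` and `w` (`y > 0`), `W ↦ fᵣ^W (liftIm 0 w + W r + i y)` is Borel measurable on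
`C(ℝ≥0, ℝ)`: the map `(x, W) ↦ fᵣ^W (liftIm 0 w + x + i y)` is continuous in the real parameter
`x` (`continuousAt_loewnerInv`) and measurable in `W` (`measurable_loewnerInv_continuousMap_apply`),
hence jointly measurable, and `W ↦ W r` is continuous. [folklore] -/
theorem measurable_loewnerInv_continuousMap_of_eq (r : ℝ≥0) (w : ℂ) {y : ℝ} (hy : 0 < y) :
    Measurable fun W : C(ℝ≥0, ℝ) ↦
      loewnerInv W r (liftIm 0 w + (W r : ℂ) + Complex.I * (y : ℂ)) := by
  have h2 : Measurable (Function.uncurry fun (x : ℝ) (W : C(ℝ≥0, ℝ)) ↦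
      loewnerInv W r (liftIm 0 w + (x : ℂ) + Complex.I * (y : ℂ))) := by
    refine measurable_uncurry_of_continuous_of_measurable (fun W ↦ ?_) (fun x ↦ ?_)
    · have hin : Continuous fun x : ℝ ↦ liftIm 0 w + (x : ℂ) + Complex.I * (y : ℂ) :=
        (continuous_const.add continuous_ofReal).add continuous_const
      refine continuous_iff_continuousAt.2 fun x ↦ ?_
      have key : Tendsto ((loewnerInv W r) ∘ fun x : ℝ ↦
          liftIm 0 w + (x : ℂ) + Complex.I * (y : ℂ)) (𝓝 x) (𝓝 _) :=
        (continuousAt_loewnerInv W.continuous r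
          (im_liftIm_add_ofReal_add_pos w x hy)).tendsto.comp hin.continuousAt
      exact key
    · exact measurable_loewnerInv_continuousMap_apply r (im_liftIm_add_ofReal_add_pos w x hy)
  exact (h2.comp ((continuous_eval_const (F := C(ℝ≥0, ℝ)) r).measurable.prodMk measurable_id) :)

/-- **Joint measurability of the inverse Loewner map in (driver, time, point).** For `y > 0` the
map `((W, r), w) ↦ fᵣ^W (liftIm 0 w + W r + i y)` is Borel measurable on
`(C(ℝ≥0, ℝ) × ℝ≥0) × ℂ`: for each `W` it is continuous in `(r, w)`
(`continuous_loewnerInv_liftIm`), for each `(r, w)` it is measurable in `W`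
(`measurable_loewnerInv_continuousMap_of_eq`), hence jointly measurable (Mathlib
`measurable_uncurry_of_continuous_of_measurable`). Rohde–Schramm (2005), §3 p. 896 ("`f̂ₛ` is
measurable with respect to the σ-field generated by `ξ(t)`, `t ∈ [0, s]`").
[cite: RohdeSchramm2005, §3 p. 896] -/
theorem measurable_loewnerInv_continuousMap {y : ℝ} (hy : 0 < y) :
    Measurable fun p : (C(ℝ≥0, ℝ) × ℝ≥0) × ℂ ↦
      Loewner.loewnerInv p.1.1 p.1.2
        (Loewner.liftIm 0 p.2 + (p.1.1 p.1.2 : ℂ) + Complex.I * (y : ℂ)) := by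
  have hu : Measurable (Function.uncurry fun (q : ℝ≥0 × ℂ) (W : C(ℝ≥0, ℝ)) ↦
      loewnerInv W q.1 (liftIm 0 q.2 + (W q.1 : ℂ) + Complex.I * (y : ℂ))) :=
    measurable_uncurry_of_continuous_of_measurable
      (fun W ↦ continuous_loewnerInv_liftIm W.continuous hy)
      (fun q ↦ measurable_loewnerInv_continuousMap_of_eq q.1 q.2 hy)
  exact (hu.comp ((measurable_fst.snd.prodMk measurable_snd).prodMk measurable_fst.fst) :)

end Loewner

/-! ### The functional `psiTilde` -/

/-- **Measurable version of the Markov-kernel parametrisation `ψ = Φ ∘ f̄ᵣ(· + W r)`.** For a map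
`Φ : ℂ → ℂ`, a driving path `W ∈ C(ℝ≥0, ℝ)`, a time `r` and a point `w`:
`psiTilde Φ W r w = limₙ Φ (fᵣ^W (liftIm 0 w + W r + i/(n+1)))`, the limit of `Φ ∘ fᵣ` along the
vertical approach from inside `ℍₒ` to the point `liftIm 0 w + W r` of the closed half-plane
(`limUnder`, junk value if the limit does not exist). When the chain of `W` is generated by a
curve and `Φ` is continuous on `{im ≥ 0}` this is `Φ (f̄ᵣ (liftIm 0 w + W r))`
(`psiTilde_eq_of_isGeneratedByCurve`), i.e. the map through which the domain Markov property of
chordal SLE pushes a fresh trace (Rohde–Schramm (2005), Thm. 5.1 with the Markov property of the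
driver; Lawler (2005), §6.3); in this form it is jointly Borel measurable in `((W, r), w)`
(`measurable_psiTilde`). [cite: RohdeSchramm2005, §3 p. 896] -/
def psiTilde (Φ : ℂ → ℂ) (W : C(ℝ≥0, ℝ)) (r : ℝ≥0) (w : ℂ) : ℂ :=
  limUnder atTop fun n : ℕ ↦
    Φ (Loewner.loewnerInv W r (Loewner.liftIm 0 w + (W r : ℂ) + Complex.I * (((1 : ℝ) / ((n : ℝ) + 1) : ℝ) : ℂ)))

/-- **`psiTilde Φ` is jointly Borel measurable in `((W, r), w)`** for Borel measurable `Φ`: it is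
the `limUnder` of the measurable maps `p ↦ Φ (fᵣ^W (liftIm 0 w + W r + i/(n+1)))`
(`Loewner.measurable_loewnerInv_continuousMap`), and such limits are (strongly) measurable (Mathlib
`MeasureTheory.StronglyMeasurable.limUnder`). Rohde–Schramm (2005), §3 p. 896.
[cite: RohdeSchramm2005, §3 p. 896] -/
theorem measurable_psiTilde {Φ : ℂ → ℂ} (hΦ : Measurable Φ) :
    Measurable fun p : (C(ℝ≥0, ℝ) × ℝ≥0) × ℂ ↦ psiTilde Φ p.1.1 p.1.2 p.2 := by
  have h : ∀ n : ℕ, StronglyMeasurable fun p : (C(ℝ≥0, ℝ) × ℝ≥0) × ℂ ↦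
      Φ (Loewner.loewnerInv p.1.1 p.1.2 (Loewner.liftIm 0 p.2 + (p.1.1 p.1.2 : ℂ) +
        Complex.I * (((1 : ℝ) / ((n : ℝ) + 1) : ℝ) : ℂ))) := fun n ↦
    (hΦ.comp (Loewner.measurable_loewnerInv_continuousMap (by positivity))).stronglyMeasurable
  exact (MeasureTheory.StronglyMeasurable.limUnder (l := atTop)
    (f := fun (n : ℕ) (p : (C(ℝ≥0, ℝ) × ℝ≥0) × ℂ) ↦
      Φ (Loewner.loewnerInv p.1.1 p.1.2 (Loewner.liftIm 0 p.2 + (p.1.1 p.1.2 : ℂ) +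
        Complex.I * (((1 : ℝ) / ((n : ℝ) + 1) : ℝ) : ℂ)))) h).measurable

/-- The vertical approach `z₀ + i/(n+1)` tends to `z₀` within `ℍₒ` when `im z₀ ≥ 0`. [folklore] -/
theorem tendsto_add_I_div_nhdsWithin {z₀ : ℂ} (hz₀ : 0 ≤ z₀.im) :
    Tendsto (fun n : ℕ ↦ z₀ + Complex.I * (((1 : ℝ) / ((n : ℝ) + 1) : ℝ) : ℂ)) atTop
      (𝓝[upperHalfPlaneSet] z₀) := by
  refine tendsto_nhdsWithin_iff.2 ⟨?_, Eventually.of_forall fun n ↦ ?_⟩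
  · have h1 : Tendsto (fun n : ℕ ↦ (1 : ℝ) / ((n : ℝ) + 1)) atTop (𝓝 0) :=
      tendsto_one_div_add_atTop_nhds_zero_nat
    have h2 : Tendsto (fun n : ℕ ↦ z₀ + Complex.I * (((1 : ℝ) / ((n : ℝ) + 1) : ℝ) : ℂ)) atTop
        (𝓝 (z₀ + Complex.I * ((0 : ℝ) : ℂ))) :=
      tendsto_const_nhds.add (tendsto_const_nhds.mul
        (continuous_ofReal.continuousAt.tendsto.comp h1))
    simpa using h2
  · show 0 < (z₀ + Complex.I * (((1 : ℝ) / ((n : ℝ) + 1) : ℝ) : ℂ)).im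
    have h : (z₀ + Complex.I * (((1 : ℝ) / ((n : ℝ) + 1) : ℝ) : ℂ)).im =
        z₀.im + 1 / ((n : ℝ) + 1) := by
      simp only [add_im, mul_im, I_re, I_im, ofReal_re, ofReal_im, zero_mul, one_mul, zero_add]
    rw [h]
    exact add_pos_of_nonneg_of_pos hz₀ (by positivity)

/-- **Identification of `psiTilde` for drivers generated by a curve.** If the Loewner chain of
`W` is generated by a curve and `Φ` is continuous on the closed half-plane `{im ≥ 0}`, then
`psiTilde Φ W r w = Φ (f̄ᵣ (liftIm 0 w + W r))`: the points `liftIm 0 w + W r + i/(n+1)` tend to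
`z₀ = liftIm 0 w + W r` within `ℍₒ`, `fᵣ → f̄ᵣ(z₀)` along them (`IsGeneratedByCurve.tendsto_bdryInv`,
Lawler (2005), Rem. 4.32), the values `fᵣ(·)` and the limit lie in `{im ≥ 0}` where `Φ` is
continuous, and `limUnder` of a convergent sequence is its limit. [cite: Lawler2005, Rem. 4.32] -/
theorem psiTilde_eq_of_isGeneratedByCurve {Φ : ℂ → ℂ} (hΦ : ContinuousOn Φ {z : ℂ | 0 ≤ z.im})
    {W : C(ℝ≥0, ℝ)} {γ : ℝ≥0 → ℂ} (hγ : Loewner.IsGeneratedByCurve W γ) (r : ℝ≥0) (w : ℂ) :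
    psiTilde Φ W r w = Φ (Loewner.bdryInv W r (Loewner.liftIm 0 w + (W r : ℂ))) := by
  have hW : Continuous (W : ℝ≥0 → ℝ) := W.continuous
  set z₀ : ℂ := Loewner.liftIm 0 w + (W r : ℂ) with hz₀
  have hz₀im : 0 ≤ z₀.im := by
    have h : z₀.im = max w.im 0 := by simp [hz₀, Loewner.liftIm_im]
    rw [h]
    exact le_max_right _ _
  -- `fᵣ → f̄ᵣ(z₀)` along the vertical approach
  have hf : Tendsto (fun n : ℕ ↦ Loewner.loewnerInv W r
      (z₀ + Complex.I * (((1 : ℝ) / ((n : ℝ) + 1) : ℝ) : ℂ))) atTop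
      (𝓝 (Loewner.bdryInv W r z₀)) :=
    (hγ.tendsto_bdryInv hW r hz₀im).comp (tendsto_add_I_div_nhdsWithin hz₀im)
  -- everything stays in the closed half-plane, where `Φ` is continuous
  have hmem : ∀ n : ℕ, Loewner.loewnerInv W r
      (z₀ + Complex.I * (((1 : ℝ) / ((n : ℝ) + 1) : ℝ) : ℂ)) ∈ {z : ℂ | 0 ≤ z.im} := fun n ↦ by
    refine (Loewner.im_loewnerInv_pos hW r ?_).le
    have h : (z₀ + Complex.I * (((1 : ℝ) / ((n : ℝ) + 1) : ℝ) : ℂ)).im =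
        z₀.im + 1 / ((n : ℝ) + 1) := by
      simp only [add_im, mul_im, I_re, I_im, ofReal_re, ofReal_im, zero_mul, one_mul, zero_add]
    rw [h]
    exact add_pos_of_nonneg_of_pos hz₀im (by positivity)
  have hlim : Loewner.bdryInv W r z₀ ∈ {z : ℂ | 0 ≤ z.im} :=
    (isClosed_le continuous_const Complex.continuous_im).mem_of_tendsto hf
      (Eventually.of_forall hmem)
  have hΦf : Tendsto (fun n : ℕ ↦ Φ (Loewner.loewnerInv W r
      (z₀ + Complex.I * (((1 : ℝ) / ((n : ℝ) + 1) : ℝ) : ℂ)))) atTop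
      (𝓝 (Φ (Loewner.bdryInv W r z₀))) :=
    (hΦ _ hlim).tendsto.comp (tendsto_nhdsWithin_iff.2 ⟨hf, Eventually.of_forall hmem⟩)
  exact hΦf.limUnder_eq

end Literature.Probability.RandomPlanarGeometry
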